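import Literature.MathematicalPhysics.QuantumLattice.HubbardTTPrimeWindowCertificateAbstractState
import HarnessLib

/-!
# The point group `D₄` acting on infinite-volume states of the lattice fermions on `ℤ²`, and the
# `D₄`-reduced window certificates read in point-group-invariant ground states

Topic `Literature/MathematicalPhysics/QuantumLattice`; namespace
`Literature.MathematicalPhysics.QuantumLattice` (the file path). Companion of `InfVolFermionState.lean`
(§3 `shift`, `IsTranslationInvariant`: the lattice translations act on states) and of
`HubbardWindowCertificateD4.lean` (the affine `D₄` maps of regions `x ↦ γ·x + w`,
`d4ShiftSet`, `PolySite.d4Emb`, and their second quantisation `Γ(d4Emb γ w Λ) : 𝔄_Λ → 𝔄_{γΛ+w}`).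

* `InfVolFermionState.d4Act γ ω` — **the transform `ω ∘ γ` of a state by a point-group element**:
  `(d4Act γ ω)_Λ(A) = ω_{γΛ}(Γ(d4Emb γ 0 Λ) A)`; again an `InfVolFermionState` (compatibility by
  functoriality of `Γ`, exactly as for `shift`); `d4Act_expect` (unfolding), `d4Act_one`.
* `InfVolFermionState.IsD4Invariant ω` — `ω ∘ γ = ω` for all `γ ∈ D₄` (Bratteli–Robinson I §4.3.1:
  `G`-invariant states, here `G` the point group of the square lattice); the Fock vacuum is an
  example (`vacuumState_isD4Invariant`).
* `IsTranslationInvariant.expect_d4Defect_eq_zero` — a translation- AND `D₄`-invariant state kills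
  every affine-`D₄` defect `Γ(incl)(Γ(d4Emb γ w Λ) Y) − Γ(incl) Y` of a window certificate
  (`Γ(d4Emb γ w Λ) = Γ(incl) ∘ Γ(τ_w) ∘ Γ(d4Emb γ 0 Λ)`).
* `InfVolFermionState.re_expect_ge_of_window_certificate_TT'_ineq_of_groundState_of_isD4Invariant` —
  the `D₄`-REDUCED window certificates (arbitrary point-group labels `γₗ`) bound every
  translation- and `D₄`-invariant Bratteli–Robinson ground state of `H(t,t',U) − μN` exactly as the
  translation-reduced ones bound every translation-invariant one
  (`re_expect_ge_of_window_certificate_TT'_ineq_of_groundState`,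
  `HubbardTTPrimeWindowCertificateAbstractState.lean`); a ground state that is not point-group
  symmetric is NOT covered by a `D₄`-reduced certificate (the same caveat as for torus limits of
  ground vectors, `HubbardNNNHoppingTorusLimitCorrelator.lean`).

Sources: O. Bratteli, D. W. Robinson, *OAQSM 1* §4.3.1 (`G`-invariant states `ω ∘ τ_g = ω`)
[BratteliRobinsonI1987]; X. Han, arXiv:2006.06002 §3 (point-group reduction of the square-lattice
bootstrap) [Han2020Bootstrap]; D. J. Scalapino, Phys. Rep. 250 (1995) §2 (the `D₄` symmetry of the
square lattice and its form factors) [Scalapino1995]. Everything is PROVED; the two definitions have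
bodies; no named fact.
-/

noncomputable section

namespace Literature.MathematicalPhysics.QuantumLattice

open Matrix Finset HubbardWave0 Literature.Probability.LatticeModels ThermodynamicLimit
open Literature.MathematicalPhysics.QuantumManyBody.StateRelaxation
open scoped ComplexOrder

/-! ### Regions under affine `D₄` maps -/

/-- `d4ShiftSet γ w` is monotone in the region. [folklore] -/
private theorem d4ShiftSet_mono (γ : DihedralGroup 4) (w : Site 2) {Λ Λ' : Finset (Site 2)} (h : Λ ⊆ Λ') :
    d4ShiftSet γ w Λ ⊆ d4ShiftSet γ w Λ' :=
  Finset.map_subset_map.2 h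

/-- `γΛ + w` is the translate by `w` of `γΛ`: `(γΛ + 0) + w ⊆ γΛ + w`. [folklore] -/
private theorem shiftSet_d4ShiftSet_zero_subset (γ : DihedralGroup 4) (w : Site 2) (Λ : Finset (Site 2)) :
    shiftSet w (d4ShiftSet γ 0 Λ) ⊆ d4ShiftSet γ w Λ := by
  intro x hx
  rw [mem_shiftSet] at hx
  obtain ⟨y, hy, hyx⟩ := Finset.mem_map.1 hx
  have h := d4Vec_add_mem_d4ShiftSet γ w hy
  have hyx' : d4Vec γ y + 0 = x - w := hyx
  rw [add_zero] at hyx'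
  rwa [hyx', sub_add_cancel] at h

/-- **`Γ(d4Emb γ w Λ) = Γ(incl) ∘ Γ(τ_w) ∘ Γ(d4Emb γ 0 Λ)`**: the second quantisation of an affine lattice
symmetry `x ↦ γx + w` of `ℤ²` factors through that of the point-group element `γ` and of the translation
`τ_w` (the space group of the square lattice is generated by the translations `T_(1,0)`, `T_(0,1)`, the
reflection `Π` and the `π/2` rotation `R`). [cite: Han2020Bootstrap, §3.2 (U_α = {T_(1,0), T_(0,1), Π, R})] -/
theorem fermionEmbed_d4Emb_eq_shift (γ : DihedralGroup 4) (w : Site 2) (Λ : Finset (Site 2))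
    (h : shiftSet w (d4ShiftSet γ 0 Λ) ⊆ d4ShiftSet γ w Λ) (Y : FermionOp Λ) :
    fermionEmbed (PolySite.d4Emb γ w Λ) Y =
      fermionEmbed (PolySite.incl h)
        (fermionEmbed (PolySite.shiftEmb w (d4ShiftSet γ 0 Λ)) (fermionEmbed (PolySite.d4Emb γ 0 Λ) Y)) := by
  rw [fermionEmbed_fermionEmbed, fermionEmbed_fermionEmbed]
  refine congrFun (congrArg DFunLike.coe (fermionEmbed_congr fun y => Subtype.ext ?_)) Y
  show toLex (d4Vec γ (ofLex y.1) + w) = toLex (ofLex (toLex (d4Vec γ (ofLex y.1) + 0)) + w)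
  rw [add_zero]
  rfl

namespace InfVolFermionState

/-! ### The point group acting on states -/

/-- **The transform `ω ∘ γ` of an infinite-volume state by a point-group element `γ ∈ D₄`**:
`(d4Act γ ω)_Λ(A) = ω_{γΛ}(Γ(d4Emb γ 0 Λ) A)` with `Γ(d4Emb γ 0 Λ) : 𝔄_Λ → 𝔄_{γΛ}`,
`c_{xσ} ↦ c_{γx,σ}`. This is again an infinite-volume state (compatibility by functoriality of `Γ`),
the fermionic-lattice instance of `ω ↦ ω ∘ τ_g` for the automorphic action of a symmetry group
(Bratteli–Robinson I §4.3.1), here the point group of `ℤ²` (Han 2020 §3; Scalapino 1995 §2).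
[cite: BratteliRobinsonI1987, §4.3.1 (G-invariant states)] -/
def d4Act (γ : DihedralGroup 4) (ω : InfVolFermionState 2) : InfVolFermionState 2 where
  expect Λ := ω.expect (d4ShiftSet γ 0 Λ) ∘ₗ (fermionEmbed (PolySite.d4Emb γ 0 Λ)).toLinearMap
  expect_one Λ := by
    rw [LinearMap.comp_apply, AlgHom.toLinearMap_apply, map_one, ω.expect_one]
  expect_nonneg Λ A := by
    rw [LinearMap.comp_apply, AlgHom.toLinearMap_apply, fermionEmbed_conjTranspose_mul_self]
    exact ω.expect_nonneg _ _
  compatible Λ Λ' h A := by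
    have h' : d4ShiftSet γ 0 Λ ⊆ d4ShiftSet γ 0 Λ' := d4ShiftSet_mono γ 0 h
    rw [LinearMap.comp_apply, AlgHom.toLinearMap_apply, LinearMap.comp_apply,
      AlgHom.toLinearMap_apply, fermionEmbed_fermionEmbed, ← ω.compatible h', fermionEmbed_fermionEmbed,
      fermionEmbed_congr (φ := (PolySite.incl h).trans (PolySite.d4Emb γ 0 Λ'))
        (ψ := (PolySite.d4Emb γ 0 Λ).trans (PolySite.incl h')) (fun y => rfl)]

/-- The local expectations of the transformed state (definitional unfolding).
[cite: BratteliRobinsonI1987, §4.3.1] -/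
theorem d4Act_expect (γ : DihedralGroup 4) (ω : InfVolFermionState 2) (Λ : Finset (Site 2)) (A : FermionOp Λ) :
    (ω.d4Act γ).expect Λ A = ω.expect (d4ShiftSet γ 0 Λ) (fermionEmbed (PolySite.d4Emb γ 0 Λ) A) :=
  rfl

/-- The identity of the point group acts trivially: `ω ∘ 1 = ω`. [cite: BratteliRobinsonI1987, §4.3.1] -/
theorem d4Act_one (ω : InfVolFermionState 2) : ω.d4Act 1 = ω := by
  refine InfVolFermionState.ext fun Λ => LinearMap.ext fun A => ?_
  rw [d4Act_expect, ω.expect_fermionEmbed_d4Emb_one_zero]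

/-- `ω` is **point-group invariant**: `ω ∘ γ = ω` for every `γ ∈ D₄`.
[cite: BratteliRobinsonI1987, §4.3.1 (G-invariant states)] -/
def IsD4Invariant (ω : InfVolFermionState 2) : Prop :=
  ∀ γ : DihedralGroup 4, ω.d4Act γ = ω

/-- **The Fock vacuum is point-group invariant** (so translation- and `D₄`-invariant states exist,
cf. `vacuumState_isTranslationInvariant`): the Fock state is invariant under every automorphism
induced by a one-particle unitary, here `c_{xσ} ↦ c_{γx,σ}`.
[cite: BratteliRobinsonII1997, §5.2.1 (the Fock state)] -/
theorem vacuumState_isD4Invariant : (vacuumState 2).IsD4Invariant := fun γ => by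
  refine InfVolFermionState.ext fun Λ => LinearMap.ext fun A => ?_
  rw [d4Act_expect, vacuumState_expect, vacuumState_expect, fermionEmbed_apply_empty_empty]

/-- **A point-group-invariant state takes the same value on every rotated copy
`Γ(d4Emb γ 0 Λ) X ∈ 𝔄_{γΛ}` of a local observable `X ∈ 𝔄_Λ` as on `X`**: `ω_{γΛ}(Γ(γ) X) = ω_Λ(X)`.
This is the hypothesis `hinv` of
`IsTorusLimitOf.re_expect_ge_of_window_certificate_d4_TT'_ineq_of_invariant`
(`HubbardNNNHoppingTorusLimitCorrelator.lean`) for every `γ`, so a `D₄`-invariant torus-limit ground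
state is bounded by an `S`-reduced certificate through that theorem, and a `D₄`-invariant
translation-invariant Bratteli–Robinson ground state through
`re_expect_ge_of_window_certificate_TT'_ineq_of_groundState_of_isD4Invariant` below.
[cite: BratteliRobinsonI1987, §4.3.1 (G-invariant states: ω(τ_g A) = ω(A))] -/
theorem IsD4Invariant.expect_fermionEmbed_d4Emb {ω : InfVolFermionState 2} (hD : ω.IsD4Invariant)
    (γ : DihedralGroup 4) (Λ : Finset (Site 2)) (X : FermionOp Λ) :
    ω.expect (d4ShiftSet γ 0 Λ) (fermionEmbed (PolySite.d4Emb γ 0 Λ) X) = ω.expect Λ X := by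
  rw [← d4Act_expect, hD γ]

/-- The same in the `∀ g ∈ S` form quantified over a set `S` of point-group labels (the literal shape
of `hinv`). [cite: BratteliRobinsonI1987, §4.3.1] -/
theorem IsD4Invariant.expect_fermionEmbed_d4Emb_of_mem {ω : InfVolFermionState 2} (hD : ω.IsD4Invariant)
    (S : Finset (DihedralGroup 4)) (Λ : Finset (Site 2)) (X : FermionOp Λ) :
    ∀ g ∈ S, ω.expect (d4ShiftSet g 0 Λ) (fermionEmbed (PolySite.d4Emb g 0 Λ) X) = ω.expect Λ X :=
  fun g _ => hD.expect_fermionEmbed_d4Emb g Λ X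

/-- **A translation- and point-group-invariant state kills every affine-`D₄` defect**: for
`γ ∈ D₄`, `w ∈ ℤ²`, `Λ ⊆ Λ'`, `γΛ + w ⊆ Λ'` and `Y ∈ 𝔄_Λ`,
`ω_{Λ'}(Γ(incl)(Γ(d4Emb γ w Λ) Y) − Γ(incl) Y) = 0` (both terms equal `ω_Λ(Y)`).
[cite: Han2020Bootstrap, §3 (symmetry constraints ⟨g·O⟩ = ⟨O⟩)] -/
theorem IsTranslationInvariant.expect_d4Defect_eq_zero {ω : InfVolFermionState 2}
    (hω : ω.IsTranslationInvariant) (hD : ω.IsD4Invariant) {Λ Λ' : Finset (Site 2)} (hΛ : Λ ⊆ Λ')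
    (γ : DihedralGroup 4) (w : Site 2) (hsh : d4ShiftSet γ w Λ ⊆ Λ') (Y : FermionOp Λ) :
    ω.expect Λ' (fermionEmbed (PolySite.incl hsh) (fermionEmbed (PolySite.d4Emb γ w Λ) Y) -
      fermionEmbed (PolySite.incl hΛ) Y) = 0 := by
  rw [map_sub, ω.compatible hΛ, ω.compatible hsh, sub_eq_zero,
    fermionEmbed_d4Emb_eq_shift γ w Λ (shiftSet_d4ShiftSet_zero_subset γ w Λ), ω.compatible, ← shift_expect, hω w,
    ← d4Act_expect, hD γ]

/-! ### `D₄`-reduced window certificates in point-group-invariant ground states -/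

section GroundStateWindow

variable {ω : InfVolFermionState 2} {t t' U μc : ℝ}
variable (hgs : ∀ (Λ : Finset (Site 2)) (A : FermionOp Λ),
    0 ≤ (ω.expect (thicken Λ 1)
      ((fermionEmbed (PolySite.incl (subset_thicken Λ 1)) A)ᴴ *
        (((hubbardTTPrimeFermionInteraction t t' U).localHamiltonian (thicken Λ 1) -
              (μc : ℂ) • (totalNumber : FermionOp (thicken Λ 1))) *
            fermionEmbed (PolySite.incl (subset_thicken Λ 1)) A -
          fermionEmbed (PolySite.incl (subset_thicken Λ 1)) A *
            ((hubbardTTPrimeFermionInteraction t t' U).localHamiltonian (thicken Λ 1) -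
              (μc : ℂ) • (totalNumber : FermionOp (thicken Λ 1)))))).re)

include hgs in
/-- **The `D₄`-reduced `t–t'` window certificates bound every translation- and point-group-invariant
ground state of `H(t,t',U) − μ_c N`.** As
`re_expect_ge_of_window_certificate_TT'_ineq_of_groundState`, with the translation-only hypothesis
`γₗ = 1` replaced by `D₄`-invariance of `ω` (`IsD4Invariant`): for `ω` translation- and `D₄`-invariant
and locally `(H^{tt'}_{Λ₁} − μ_c N_{Λ₁})`-stable on every region, `U ≥ 0`, `0 < ρ(ω) < 2`,
`energyDensityTT' t t' U ρ(ω) ≤ u`, `κ ≥ 0`, a certificate with arbitrary affine-`D₄` defects, particle-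
number-conserving eom generators and `ω` vanishing on its charged words:
`c − Σₖ ‖aₖ‖ + Σ_σ μ_σ (Re ω_{Λ'}(n_{0σ}) − ν) ≤ Re ω_{Λ'}(Xw)`. (Not point-group-symmetric ground
states are not covered by such a certificate.) [cite: WangEtAl2024, §III] -/
theorem re_expect_ge_of_window_certificate_TT'_ineq_of_groundState_of_isD4Invariant
    (hω : ω.IsTranslationInvariant) (hD : ω.IsD4Invariant)
    (hU : 0 ≤ U) (hρ0 : 0 < ω.density) (hρ2 : ω.density < 2)
    {Λ Λ' : Finset (Site 2)} (hΛ : Λ ⊆ Λ') (h8 : thicken Λ 1 ⊆ Λ')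
    (h0 : thicken ({0} : Finset (Site 2)) 1 ⊆ Λ') (hz : (0 : Site 2) ∈ Λ')
    (Xw : FermionOp Λ') {κ u : ℝ} (hκ : 0 ≤ κ) (hu : energyDensityTT' t t' U ω.density ≤ u)
    (μ : Fin 2 → ℝ) (ν : ℝ)
    {m : Type*} [Fintype m] [DecidableEq m] {Λm : Matrix m m ℂ} (hΛm : Λm.PosSemidef)
    (O : m → FermionOp Λ')
    {κ' : Type*} (s : Finset κ') (B : κ' → FermionOp Λ) (hB : ∀ k ∈ s, Commute (B k) (totalNumber : FermionOp Λ))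
    {ι : Type*} (tt : Finset ι) (γ : ι → DihedralGroup 4) (wv : ι → Site 2)
    (hsh : ∀ l, d4ShiftSet (γ l) (wv l) Λ ⊆ Λ') (Y : ι → FermionOp Λ)
    {ρ : Type*} (uu : Finset ρ) (b : ρ → ℂ) (cw : ρ → List (Orb (PolySite Λ') × Bool))
    (hch : ∀ j ∈ uu, ω.expect Λ' (ladderWord (cw j)) = 0)
    {δ : Type*} (ah : Finset δ) (dc : δ → ℝ) (V : δ → FermionOp Λ')
    {κ'' : Type*} (w : Finset κ'') (a : κ'' → ℂ) (word : κ'' → List (Orb (PolySite Λ') × Bool)) {c : ℝ}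
    (hcert : Xw - (c : ℂ) • (1 : FermionOp Λ') -
        ∑ σ : Fin 2, ((μ σ : ℝ) : ℂ) • (nAt 0 hz σ - ((ν : ℝ) : ℂ) • (1 : FermionOp Λ')) -
        ((κ : ℝ) : ℂ) • (((u : ℝ) : ℂ) • (1 : FermionOp Λ') -
          fermionEmbed (PolySite.incl h0) ((hubbardTTPrimeFermionInteraction t t' U).meanEnergyObs 1)) =
      gramForm Λm O +
        (∑ k ∈ s, ((hubbardTTPrimeFermionInteraction t t' U).localHamiltonian Λ' * fermionEmbed (PolySite.incl hΛ) (B k) -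
            fermionEmbed (PolySite.incl hΛ) (B k) * (hubbardTTPrimeFermionInteraction t t' U).localHamiltonian Λ') +
          ∑ l ∈ tt, (fermionEmbed (PolySite.incl (hsh l)) (fermionEmbed (PolySite.d4Emb (γ l) (wv l) Λ) (Y l)) -
            fermionEmbed (PolySite.incl hΛ) (Y l)) +
          ∑ j ∈ uu, b j • ladderWord (cw j)) +
        (∑ m' ∈ ah, ((dc m' : ℝ) : ℂ) • ((V m')ᴴ - V m') + ∑ k ∈ w, a k • ladderWord (word k))) :
    c - ∑ k ∈ w, ‖a k‖ + ∑ σ : Fin 2, μ σ * ((ω.expect Λ' (nAt 0 hz σ)).re - ν) ≤ (ω.expect Λ' Xw).re := by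
  have hsym : ∀ l ∈ tt, ω.expect Λ'
      (fermionEmbed (PolySite.incl (hsh l)) (fermionEmbed (PolySite.d4Emb (γ l) (wv l) Λ) (Y l)) -
        fermionEmbed (PolySite.incl hΛ) (Y l)) = 0 :=
    fun l _ => hω.expect_d4Defect_eq_zero hD hΛ (γ l) (wv l) (hsh l) (Y l)
  have heom : ∀ k ∈ s, ω.expect Λ'
      ((hubbardTTPrimeFermionInteraction t t' U).localHamiltonian Λ' * fermionEmbed (PolySite.incl hΛ) (B k) -
        fermionEmbed (PolySite.incl hΛ) (B k) * (hubbardTTPrimeFermionInteraction t t' U).localHamiltonian Λ') = 0 :=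
    fun k hk => expect_commutator_localHamiltonian_eq_zero_of_thicken_subset hgs hΛ h8 (hB k hk)
  have h := ω.re_expect_ge_of_window_certificate_TT'_ineq_of_nulls t t' U hΛ h0 hz Xw κ u μ ν hΛm O s B tt γ wv
    hsh Y uu b cw ah dc V w a word hcert heom hsym hch
  have he : ω.meanEnergy (hubbardTTPrimeFermionInteraction t t' U) 1 = energyDensityTT' t t' U ω.density :=
    meanEnergy_eq_energyDensityTT'_of_groundState hgs hω hU hρ0 hρ2
  rw [he] at h
  nlinarith [mul_nonneg hκ (sub_nonneg.2 hu)]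

end GroundStateWindow

end InfVolFermionState

end Literature.MathematicalPhysics.QuantumLattice

end
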